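import Mathlib
import HarnessLib
import Summits.NavierStokesRegularity.NavierStokesRegularity.Theorems.UnthreadedDoorNetFluxDefs
import Summits.NavierStokesRegularity.NavierStokesRegularity.Theorems.UnthreadedDoorNetFluxAnalyticLevelChart

/-!
# Route `UnthreadedDoor`, crux `PoloidalLiouville` (stmt-NavierStokesRegularity-1222), WALL W1 — «height-head» K1⁺:
# GLUING THE ANALYTIC VALUE GERMS ALONG A CHAIN OF CHARTS (the slice inequality between regular points)

Core of ARM A's proof of K1⁺ `LevelLipschitzOfAnalyticIsolated` (ns-idea-14's crux idea «height-head») WITHOUT any analysis at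
the critical points: on the sphere `S = S_r(x₀)` let `f, μ` be real-analytic and `g ∈ C¹` off `x₀`, `∇g − μ∇f ∥ (x − x₀)` on `S`,
`|μ| ≤ L` on `S`, and let the set `Reg` of REGULAR points of `f|_S` (`∇f × (x − x₀) ≠ 0`) be preconnected.  Then for all
`x, y ∈ Reg`:  `|g x − g y| ≤ L |f x − f y|`.

Proof (`slice_le_of_analytic_regular`): every regular `z` carries an analytic level chart (`exists_analyticLevelChart`, H1):
`g = G_z ∘ f` on `W_z ∩ S`, `G_z′ = γ_z` real-analytic on the value interval `J_z`, `|γ_z| ≤ L`.  The chart domains cover the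
preconnected `Reg`, so `x` and `y` are joined by a CHAIN of charts with consecutive domains meeting in `Reg` (tree lemma
`Literature.Topology.IsPreconnected.reflTransGen_of_subset_iUnion`).  Along the chain one glues a single differentiable value
function `𝔊` on the interval `⋃ J` with analytic derivative `Υ`, `|Υ| ≤ L`: at a common regular point `w` of two consecutive
domains the values near `f w` are attained inside the intersection (H1 with a prescribed neighbourhood), so the two value
functions agree near `f w`, hence their analytic derivatives agree on the whole common interval (identity theorem
`AnalyticOnNhd.eqOn_of_preconnected_of_eventuallyEq`), hence the functions agree there (zero derivative, one common value).
Finally `g x = 𝔊(f x)`, `g y = 𝔊(f y)` and the mean value inequality give the slice inequality.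

WHAT THIS IS NOT: no NS statement; no critical-point analysis (K1a/K1b of the sketch are bypassed); every height-head Prop,
`PoloidalLiouville` (1222), W1 and NS regularity stay OPEN.  `--supports stmt-NavierStokesRegularity-1222 --as helper`.  [folklore]
-/

noncomputable section

-- the summit and its single sub-problem share the name (CONVENTIONS §1)
set_option linter.dupNamespace false

open Set Function Filter Topology InnerProductSpace Metric Relation
open scoped RealInnerProductSpace ContDiff

namespace Summit.NavierStokesRegularity.NavierStokesRegularity.Theorems.PoloidalLiouville.NetFlux

open Literature.Analysis Literature.Analysis.FluidPDE

section Gluing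

variable {f g μ : E3 → ℝ} {x₀ : E3} {r L : ℝ}

/-- **An open cover of a preconnected set is chain-connected** (Hatcher, *Algebraic Topology* §3.3 p. 235; the tree's
`Literature.Topology.IsPreconnected.reflTransGen_of_subset_iUnion`, restated here with the linking relation spelled
`∃ z ∈ S, z ∈ U a ∧ z ∈ U b` because that module is not built on the check farm at the time of writing). [folklore] -/
theorem reflTransGen_of_cover {X : Type*} [TopologicalSpace X] {S : Set X} (hS : IsPreconnected S) {ι : Type*}
    {U : ι → Set X} (hU : ∀ i, IsOpen (U i)) (hcov : S ⊆ ⋃ i, U i) {i j : ι} {s t : X} (hs : s ∈ S) (hsi : s ∈ U i)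
    (ht : t ∈ S) (htj : t ∈ U j) : ReflTransGen (fun a b => ∃ z ∈ S, z ∈ U a ∧ z ∈ U b) i j := by
  classical
  by_contra hj
  let A : Set X := ⋃ (l : ι) (_ : ReflTransGen (fun a b => ∃ z ∈ S, z ∈ U a ∧ z ∈ U b) i l), U l
  let B : Set X := ⋃ (l : ι) (_ : ¬ ReflTransGen (fun a b => ∃ z ∈ S, z ∈ U a ∧ z ∈ U b) i l), U l
  have hA : IsOpen A := isOpen_iUnion fun l => isOpen_iUnion fun _ => hU l
  have hB : IsOpen B := isOpen_iUnion fun l => isOpen_iUnion fun _ => hU l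
  have hSAB : S ⊆ A ∪ B := by
    intro x hx
    obtain ⟨l, hl⟩ := mem_iUnion.1 (hcov hx)
    by_cases h : ReflTransGen (fun a b => ∃ z ∈ S, z ∈ U a ∧ z ∈ U b) i l
    · exact Or.inl (mem_iUnion₂.2 ⟨l, h, hl⟩)
    · exact Or.inr (mem_iUnion₂.2 ⟨l, h, hl⟩)
  obtain ⟨x, hxS, hxA, hxB⟩ := hS A B hA hB hSAB ⟨s, hs, mem_iUnion₂.2 ⟨i, ReflTransGen.refl, hsi⟩⟩
    ⟨t, ht, mem_iUnion₂.2 ⟨j, hj, htj⟩⟩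
  obtain ⟨l, hl, hxl⟩ := mem_iUnion₂.1 hxA
  obtain ⟨l', hl', hxl'⟩ := mem_iUnion₂.1 hxB
  exact hl' (hl.tail ⟨x, hxS, hxl, hxl'⟩)

/-- One gluing step on the line: a differentiable `𝔊` on an open preconnected `U ⊆ ℝ` with analytic derivative `Υ`, and a
function `G` on an open interval `J` with analytic derivative `γ`, which AGREE near a point of `U ∩ J`, glue to a differentiable
function on `U ∪ J` with analytic derivative (identity theorem for the derivatives + mean value). [folklore] -/
theorem glue_step {U J : Set ℝ} {𝔊 Υ G γ : ℝ → ℝ} {L c₀ : ℝ} (hUo : IsOpen U) (hUc : IsPreconnected U)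
    (hJo : IsOpen J) (hJc : IsPreconnected J)
    (hD : ∀ u ∈ U, HasDerivAt 𝔊 (Υ u) u) (hΥ : AnalyticOnNhd ℝ Υ U) (hΥL : ∀ u ∈ U, |Υ u| ≤ L)
    (hDG : ∀ u ∈ J, HasDerivAt G (γ u) u) (hγ : AnalyticOnNhd ℝ γ J) (hγL : ∀ u ∈ J, |γ u| ≤ L)
    (hc₀U : c₀ ∈ U) (hc₀J : c₀ ∈ J) (hagree : 𝔊 =ᶠ[𝓝 c₀] G) :
    ∃ 𝔊' Υ' : ℝ → ℝ, (∀ u ∈ U ∪ J, HasDerivAt 𝔊' (Υ' u) u) ∧ AnalyticOnNhd ℝ Υ' (U ∪ J) ∧ (∀ u ∈ U ∪ J, |Υ' u| ≤ L) ∧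
      EqOn 𝔊' 𝔊 U ∧ EqOn 𝔊' G J := by
  classical
  -- the derivatives agree near `c₀`, hence on all of `U ∩ J`
  have hderiv_near : Υ =ᶠ[𝓝 c₀] γ := by
    have h1 : ∀ᶠ u in 𝓝 c₀, u ∈ U ∩ J := (hUo.inter hJo).mem_nhds ⟨hc₀U, hc₀J⟩
    have h2 : ∀ᶠ u in 𝓝 c₀, 𝔊 =ᶠ[𝓝 u] G := hagree.eventually_nhds
    filter_upwards [h1, h2] with u hu hug
    exact ((hD u hu.1).congr_of_eventuallyEq hug.symm).unique (hDG u hu.2)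
  have hVconn : IsPreconnected (U ∩ J) := by
    rw [← Real.convex_iff_isPreconnected] at hUc hJc ⊢
    exact hUc.inter hJc
  have hΥγ : EqOn Υ γ (U ∩ J) :=
    (hΥ.mono inter_subset_left).eqOn_of_preconnected_of_eventuallyEq (hγ.mono inter_subset_right) hVconn
      ⟨hc₀U, hc₀J⟩ hderiv_near
  -- hence the functions agree on `U ∩ J` (zero derivative on a convex set, equal at `c₀`)
  have h𝔊G : EqOn 𝔊 G (U ∩ J) := by
    intro u hu
    have hconv : Convex ℝ (U ∩ J) := Real.convex_iff_isPreconnected.2 hVconn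
    have hmv := Convex.norm_image_sub_le_of_norm_hasDerivWithin_le (f := fun t => 𝔊 t - G t) (f' := fun _ => (0 : ℝ))
      (C := 0) (s := U ∩ J) (fun t ht => ?_) (fun t _ => by simp) hconv ⟨hc₀U, hc₀J⟩ hu
    · rw [zero_mul, hagree.self_of_nhds, sub_self, sub_zero, norm_le_zero_iff, sub_eq_zero] at hmv
      exact hmv
    · have h := (hD t ht.1).sub (hDG t ht.2)
      rw [hΥγ ht, sub_self] at h
      exact h.hasDerivWithinAt
  -- the glued functions
  refine ⟨fun u => if u ∈ U then 𝔊 u else G u, fun u => if u ∈ U then Υ u else γ u, ?_, ?_, ?_, ?_, ?_⟩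
  · -- derivative
    intro u hu
    by_cases huU : u ∈ U
    · have heq : (fun u => if u ∈ U then 𝔊 u else G u) =ᶠ[𝓝 u] 𝔊 := by
        filter_upwards [hUo.mem_nhds huU] with t ht
        simp [ht]
      have hval : (fun u => if u ∈ U then Υ u else γ u) u = Υ u := by simp [huU]
      rw [hval]
      exact (hD u huU).congr_of_eventuallyEq heq
    · have huJ : u ∈ J := hu.resolve_left huU
      have heq : (fun u => if u ∈ U then 𝔊 u else G u) =ᶠ[𝓝 u] G := by
        filter_upwards [hJo.mem_nhds huJ] with t ht
        by_cases htU : t ∈ U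
        · simp [htU, h𝔊G ⟨htU, ht⟩]
        · simp [htU]
      have hval : (fun u => if u ∈ U then Υ u else γ u) u = γ u := by simp [huU]
      rw [hval]
      exact (hDG u huJ).congr_of_eventuallyEq heq
  · -- analyticity of the derivative
    intro u hu
    by_cases huU : u ∈ U
    · have heq : (fun u => if u ∈ U then Υ u else γ u) =ᶠ[𝓝 u] Υ := by
        filter_upwards [hUo.mem_nhds huU] with t ht
        simp [ht]
      exact (hΥ u huU).congr heq.symm
    · have huJ : u ∈ J := hu.resolve_left huU
      have heq : (fun u => if u ∈ U then Υ u else γ u) =ᶠ[𝓝 u] γ := by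
        filter_upwards [hJo.mem_nhds huJ] with t ht
        by_cases htU : t ∈ U
        · simp [htU, hΥγ ⟨htU, ht⟩]
        · simp [htU]
      exact (hγ u huJ).congr heq.symm
  · intro u hu
    by_cases huU : u ∈ U
    · simp only [if_pos huU]; exact hΥL u huU
    · simp only [if_neg huU]; exact hγL u (hu.resolve_left huU)
  · intro u hu; simp [hu]
  · intro u hu
    by_cases huU : u ∈ U
    · simp only [if_pos huU]; exact h𝔊G ⟨huU, hu⟩
    · simp only [if_neg huU]

/-- **The slice inequality between REGULAR points, for analytic `f, μ` and a preconnected regular set** (see the module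
docstring). [folklore] -/
theorem slice_le_of_analytic_regular (hr : 0 < r) (hf : AnalyticOnNhd ℝ f ({x₀}ᶜ : Set E3))
    (hμ : AnalyticOnNhd ℝ μ ({x₀}ᶜ : Set E3)) (hg : ContDiffOn ℝ 1 g ({x₀}ᶜ : Set E3))
    (hpar : ∀ x ∈ Metric.sphere x₀ r, cross (gradient g x - μ x • gradient f x) (x - x₀) = 0)
    (hL : ∀ x ∈ Metric.sphere x₀ r, |μ x| ≤ L)
    (hconn : IsPreconnected (Metric.sphere x₀ r \ {x : E3 | x ∈ Metric.sphere x₀ r ∧ cross (gradient f x) (x - x₀) = 0}))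
    {x y : E3} (hx : x ∈ Metric.sphere x₀ r) (hxr : cross (gradient f x) (x - x₀) ≠ 0)
    (hy : y ∈ Metric.sphere x₀ r) (hyr : cross (gradient f y) (y - x₀) ≠ 0) :
    |g x - g y| ≤ L * |f x - f y| := by
  classical
  set S : Set E3 := Metric.sphere x₀ r with hS
  set Reg : Set E3 := S \ {x : E3 | x ∈ S ∧ cross (gradient f x) (x - x₀) = 0} with hReg
  have hRegS : Reg ⊆ S := fun z hz => hz.1
  have hReg_iff : ∀ z, z ∈ Reg ↔ z ∈ S ∧ cross (gradient f z) (z - x₀) ≠ 0 := fun z =>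
    ⟨fun h => ⟨h.1, fun h0 => h.2 ⟨h.1, h0⟩⟩, fun h => ⟨h.1, fun h0 => h.2 h0.2⟩⟩
  -- analytic charts at all regular points (inside a prescribed neighbourhood)
  have hchart : ∀ z : E3, ∀ O : Set E3, z ∈ Reg → O ∈ 𝓝 z →
      ∃ W : Set E3, ∃ ε : ℝ, ∃ G γ : ℝ → ℝ, IsOpen W ∧ z ∈ W ∧ W ⊆ O ∧ 0 < ε ∧
        (∀ x ∈ W, x ∈ S → f x ∈ Ioo (f z - ε) (f z + ε) ∧ g x = G (f x)) ∧
        (∀ c ∈ Ioo (f z - ε) (f z + ε), ∃ x ∈ W, x ∈ S ∧ f x = c ∧ γ c = μ x ∧ HasDerivAt G (γ c) c) ∧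
        AnalyticOnNhd ℝ γ (Ioo (f z - ε) (f z + ε)) := by
    intro z O hz hO
    obtain ⟨W, hWo, hzW, hWO, ε, hε, G, γ, h1, h2, h3⟩ :=
      exists_analyticLevelChart hr hf hμ hg hpar ((hReg_iff z).1 hz).1 ((hReg_iff z).1 hz).2 hO
    exact ⟨W, ε, G, γ, hWo, hzW, hWO, hε, h1, h2, h3⟩
  choose! W ε G γ hWo hzW hWO hε hA1 hA2 hA3 using hchart
  -- the charts with `O = univ`, indexed by the regular points
  set ι := {z : E3 // z ∈ Reg} with hι
  have hcov : Reg ⊆ ⋃ i : ι, W i.1 univ := fun z hz => mem_iUnion.2 ⟨⟨z, hz⟩, hzW z univ hz univ_mem⟩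
  have hxR : x ∈ Reg := (hReg_iff x).2 ⟨hx, hxr⟩
  have hyR : y ∈ Reg := (hReg_iff y).2 ⟨hy, hyr⟩
  have hchain := reflTransGen_of_cover hconn (U := fun i : ι => W i.1 univ) (fun i => hWo i.1 univ i.2 univ_mem) hcov
    (i := ⟨x, hxR⟩) (j := ⟨y, hyR⟩) hxR (hzW x univ hxR univ_mem) hyR (hzW y univ hyR univ_mem)
  -- abbreviations for the chart data with `O = univ`
  set J : ι → Set ℝ := fun i => Ioo (f i.1 - ε i.1 univ) (f i.1 + ε i.1 univ) with hJ
  have hJo : ∀ i : ι, IsOpen (J i) := fun i => isOpen_Ioo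
  have hJc : ∀ i : ι, IsPreconnected (J i) := fun i => isPreconnected_Ioo
  have hDG : ∀ i : ι, ∀ u ∈ J i, HasDerivAt (G i.1 univ) (γ i.1 univ u) u := fun i u hu => by
    obtain ⟨x', -, -, -, -, hd⟩ := hA2 i.1 univ i.2 univ_mem u hu
    exact hd
  have hγan : ∀ i : ι, AnalyticOnNhd ℝ (γ i.1 univ) (J i) := fun i => hA3 i.1 univ i.2 univ_mem
  have hγL : ∀ i : ι, ∀ u ∈ J i, |γ i.1 univ u| ≤ L := fun i u hu => by
    obtain ⟨x', -, hx'S, -, hγx, -⟩ := hA2 i.1 univ i.2 univ_mem u hu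
    rw [hγx]; exact hL x' hx'S
  -- the gluing invariant along the chain from `⟨x, hxR⟩`
  have key : ∀ l : ι, ReflTransGen (fun a b : ι => ∃ z ∈ Reg, z ∈ W a.1 univ ∧ z ∈ W b.1 univ) ⟨x, hxR⟩ l →
      ∃ (U : Set ℝ) (𝔊 Υ : ℝ → ℝ), IsOpen U ∧ IsPreconnected U ∧ J ⟨x, hxR⟩ ⊆ U ∧ J l ⊆ U ∧
        (∀ u ∈ U, HasDerivAt 𝔊 (Υ u) u) ∧ AnalyticOnNhd ℝ Υ U ∧ (∀ u ∈ U, |Υ u| ≤ L) ∧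
        EqOn 𝔊 (G x univ) (J ⟨x, hxR⟩) ∧ EqOn 𝔊 (G l.1 univ) (J l) := by
    intro l hl
    induction hl with
    | refl =>
      exact ⟨J ⟨x, hxR⟩, G x univ, γ x univ, hJo _, hJc _, Subset.rfl, Subset.rfl, hDG ⟨x, hxR⟩, hγan ⟨x, hxR⟩,
        hγL ⟨x, hxR⟩, fun _ _ => rfl, fun _ _ => rfl⟩
    | @tail b c _ hbc ih =>
      obtain ⟨U, 𝔊, Υ, hUo, hUc, hJxU, hJbU, hD, hΥ, hΥL, hEx, hEb⟩ := ih
      obtain ⟨w, hwR, hwb, hwc⟩ := hbc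
      -- values near `f w` are attained inside `W b ∩ W c`
      have hO : W b.1 univ ∩ W c.1 univ ∈ 𝓝 w :=
        ((hWo b.1 univ b.2 univ_mem).inter (hWo c.1 univ c.2 univ_mem)).mem_nhds ⟨hwb, hwc⟩
      have hwS : w ∈ S := hRegS hwR
      have hfwb : f w ∈ J b := (hA1 b.1 univ b.2 univ_mem w hwb hwS).1
      have hfwc : f w ∈ J c := (hA1 c.1 univ c.2 univ_mem w hwc hwS).1
      have hagree : G b.1 univ =ᶠ[𝓝 (f w)] G c.1 univ := by
        have hεw := hε w (W b.1 univ ∩ W c.1 univ) hwR hO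
        filter_upwards [Ioo_mem_nhds (show f w - ε w (W b.1 univ ∩ W c.1 univ) < f w by linarith)
          (show f w < f w + ε w (W b.1 univ ∩ W c.1 univ) by linarith)] with u hu
        obtain ⟨x', hx'W, hx'S, hfx', -, -⟩ := hA2 w (W b.1 univ ∩ W c.1 univ) hwR hO u hu
        have hx'bc := hWO w (W b.1 univ ∩ W c.1 univ) hwR hO hx'W
        rw [← hfx', ← (hA1 b.1 univ b.2 univ_mem x' hx'bc.1 hx'S).2, ← (hA1 c.1 univ c.2 univ_mem x' hx'bc.2 hx'S).2]
      have hagree' : 𝔊 =ᶠ[𝓝 (f w)] G c.1 univ := by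
        have h1 : 𝔊 =ᶠ[𝓝 (f w)] G b.1 univ := by
          filter_upwards [(hJo b).mem_nhds hfwb] with u hu
          exact hEb hu
        exact h1.trans hagree
      obtain ⟨𝔊', Υ', hD', hΥ', hΥL', hE𝔊, hEc⟩ := glue_step hUo hUc (hJo c) (hJc c) hD hΥ hΥL (hDG c) (hγan c)
        (hγL c) (hJbU hfwb) hfwc hagree'
      refine ⟨U ∪ J c, 𝔊', Υ', hUo.union (hJo c), ?_, hJxU.trans subset_union_left, subset_union_right, hD', hΥ',
        hΥL', fun u hu => (hE𝔊 (hJxU hu)).trans (hEx hu), hEc⟩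
      exact hUc.union (f w) (hJbU hfwb) hfwc (hJc c)
  -- conclude by the mean value inequality on the glued interval
  obtain ⟨U, 𝔊, Υ, -, hUc, hJxU, hJyU, hD, -, hΥL, hEx, hEy⟩ := key ⟨y, hyR⟩ hchain
  have hfx : f x ∈ J ⟨x, hxR⟩ := (hA1 x univ hxR univ_mem x (hzW x univ hxR univ_mem) hx).1
  have hfy : f y ∈ J ⟨y, hyR⟩ := (hA1 y univ hyR univ_mem y (hzW y univ hyR univ_mem) hy).1
  have hgx : g x = 𝔊 (f x) := by rw [(hA1 x univ hxR univ_mem x (hzW x univ hxR univ_mem) hx).2, hEx hfx]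
  have hgy : g y = 𝔊 (f y) := by rw [(hA1 y univ hyR univ_mem y (hzW y univ hyR univ_mem) hy).2, hEy hfy]
  have hconv : Convex ℝ U := Real.convex_iff_isPreconnected.2 hUc
  have hmv := Convex.norm_image_sub_le_of_norm_hasDerivWithin_le (f := 𝔊) (f' := Υ) (C := L) (s := U)
    (fun u hu => (hD u hu).hasDerivWithinAt) (fun u hu => by rw [Real.norm_eq_abs]; exact hΥL u hu) hconv
    (hJyU hfy) (hJxU hfx)
  rw [Real.norm_eq_abs, Real.norm_eq_abs] at hmv
  rw [hgx, hgy]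
  exact hmv

end Gluing

/-! ### The CELL form: the slice inequality on any preconnected set of regular points, and on its closure

(Appended 2026-08-31, seat leafhand-ns-unthreadeddoor-3 g7, `--supports stmt-NavierStokesRegularity-1222 --as helper`.)  The chain-of-charts
argument of `slice_le_of_analytic_regular` never uses that the chain carrier is the WHOLE regular set of the sphere: any preconnected set `C` of
regular points of `f|_{S_r(x₀)}` will do (charts indexed by the points of `C`, links inside `C`).  This is the form the cell-flux / indicatrix
chain of crux idea «cell-flux» needs (Λ-1 `HeadClusterRuleTame`, `Cruxes/PoloidalLiouville/IndicatrixSketch.lean` §3; Theorems-side defs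
`CellFlux.HeadCoherent`, `CellFlux.cellOf` in `…UnthreadedDoorCellFluxDefs`): a CELL of `S_r ∖ Γ` (`Γ` = the non-isolated sphere-critical points)
minus its finitely many isolated critical points is a preconnected set of regular points, so the head `g` is ONE `L`-Lipschitz function of the
potential `f` on the cell and, by the closure form, on its closure (sheet traces included) — «head coherence of a cell» for analytic slices,
multi-hill cells included.  No statement about Navier–Stokes; `PoloidalLiouville` (1222), W1 and NS regularity stay OPEN. [folklore] -/

section GluingOnSubsets

variable {f g μ : E3 → ℝ} {x₀ : E3} {r L : ℝ}

/-- **Slice inequality on a preconnected set of regular points (cell form of K1⁺).**  On the sphere `S = S_r(x₀)` (`r > 0`) let `f, μ` be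
real-analytic and `g ∈ C¹` off `x₀`, `∇g − μ∇f ∥ (x − x₀)` on `S` and `|μ| ≤ L` on `S`.  If `C ⊆ S` is PRECONNECTED and consists of regular
points of `f|_S` (`∇f × (x − x₀) ≠ 0` on `C`), then `|g x − g y| ≤ L |f x − f y|` for all `x, y ∈ C`.  (Same proof as
`slice_le_of_analytic_regular`, charts indexed by `C`; `C` need not be open.) [folklore] -/
theorem slice_le_of_analytic_regular_on (hr : 0 < r) (hf : AnalyticOnNhd ℝ f ({x₀}ᶜ : Set E3))
    (hμ : AnalyticOnNhd ℝ μ ({x₀}ᶜ : Set E3)) (hg : ContDiffOn ℝ 1 g ({x₀}ᶜ : Set E3))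
    (hpar : ∀ x ∈ Metric.sphere x₀ r, cross (gradient g x - μ x • gradient f x) (x - x₀) = 0)
    (hL : ∀ x ∈ Metric.sphere x₀ r, |μ x| ≤ L)
    {C : Set E3} (hCS : C ⊆ Metric.sphere x₀ r) (hCreg : ∀ z ∈ C, cross (gradient f z) (z - x₀) ≠ 0)
    (hconn : IsPreconnected C) {x y : E3} (hx : x ∈ C) (hy : y ∈ C) :
    |g x - g y| ≤ L * |f x - f y| := by
  classical
  set S : Set E3 := Metric.sphere x₀ r with hS
  -- analytic charts at all points of `C` (inside a prescribed neighbourhood)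
  have hchart : ∀ z : E3, ∀ O : Set E3, z ∈ C → O ∈ 𝓝 z →
      ∃ W : Set E3, ∃ ε : ℝ, ∃ G γ : ℝ → ℝ, IsOpen W ∧ z ∈ W ∧ W ⊆ O ∧ 0 < ε ∧
        (∀ x ∈ W, x ∈ S → f x ∈ Ioo (f z - ε) (f z + ε) ∧ g x = G (f x)) ∧
        (∀ c ∈ Ioo (f z - ε) (f z + ε), ∃ x ∈ W, x ∈ S ∧ f x = c ∧ γ c = μ x ∧ HasDerivAt G (γ c) c) ∧
        AnalyticOnNhd ℝ γ (Ioo (f z - ε) (f z + ε)) := by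
    intro z O hz hO
    obtain ⟨W, hWo, hzW, hWO, ε, hε, G, γ, h1, h2, h3⟩ :=
      exists_analyticLevelChart hr hf hμ hg hpar (hCS hz) (hCreg z hz) hO
    exact ⟨W, ε, G, γ, hWo, hzW, hWO, hε, h1, h2, h3⟩
  choose! W ε G γ hWo hzW hWO hε hA1 hA2 hA3 using hchart
  -- the charts with `O = univ`, indexed by the points of `C`
  set ι := {z : E3 // z ∈ C} with hι
  have hcov : C ⊆ ⋃ i : ι, W i.1 univ := fun z hz => mem_iUnion.2 ⟨⟨z, hz⟩, hzW z univ hz univ_mem⟩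
  have hchain := reflTransGen_of_cover hconn (U := fun i : ι => W i.1 univ) (fun i => hWo i.1 univ i.2 univ_mem) hcov
    (i := ⟨x, hx⟩) (j := ⟨y, hy⟩) hx (hzW x univ hx univ_mem) hy (hzW y univ hy univ_mem)
  -- abbreviations for the chart data with `O = univ`
  set J : ι → Set ℝ := fun i => Ioo (f i.1 - ε i.1 univ) (f i.1 + ε i.1 univ) with hJ
  have hJo : ∀ i : ι, IsOpen (J i) := fun i => isOpen_Ioo
  have hJc : ∀ i : ι, IsPreconnected (J i) := fun i => isPreconnected_Ioo
  have hDG : ∀ i : ι, ∀ u ∈ J i, HasDerivAt (G i.1 univ) (γ i.1 univ u) u := fun i u hu => by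
    obtain ⟨x', -, -, -, -, hd⟩ := hA2 i.1 univ i.2 univ_mem u hu
    exact hd
  have hγan : ∀ i : ι, AnalyticOnNhd ℝ (γ i.1 univ) (J i) := fun i => hA3 i.1 univ i.2 univ_mem
  have hγL : ∀ i : ι, ∀ u ∈ J i, |γ i.1 univ u| ≤ L := fun i u hu => by
    obtain ⟨x', -, hx'S, -, hγx, -⟩ := hA2 i.1 univ i.2 univ_mem u hu
    rw [hγx]; exact hL x' hx'S
  -- the gluing invariant along the chain from `⟨x, hx⟩`
  have key : ∀ l : ι, ReflTransGen (fun a b : ι => ∃ z ∈ C, z ∈ W a.1 univ ∧ z ∈ W b.1 univ) ⟨x, hx⟩ l →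
      ∃ (U : Set ℝ) (𝔊 Υ : ℝ → ℝ), IsOpen U ∧ IsPreconnected U ∧ J ⟨x, hx⟩ ⊆ U ∧ J l ⊆ U ∧
        (∀ u ∈ U, HasDerivAt 𝔊 (Υ u) u) ∧ AnalyticOnNhd ℝ Υ U ∧ (∀ u ∈ U, |Υ u| ≤ L) ∧
        EqOn 𝔊 (G x univ) (J ⟨x, hx⟩) ∧ EqOn 𝔊 (G l.1 univ) (J l) := by
    intro l hl
    induction hl with
    | refl =>
      exact ⟨J ⟨x, hx⟩, G x univ, γ x univ, hJo _, hJc _, Subset.rfl, Subset.rfl, hDG ⟨x, hx⟩, hγan ⟨x, hx⟩,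
        hγL ⟨x, hx⟩, fun _ _ => rfl, fun _ _ => rfl⟩
    | @tail b c _ hbc ih =>
      obtain ⟨U, 𝔊, Υ, hUo, hUc, hJxU, hJbU, hD, hΥ, hΥL, hEx, hEb⟩ := ih
      obtain ⟨w, hwC, hwb, hwc⟩ := hbc
      -- values near `f w` are attained inside `W b ∩ W c`
      have hO : W b.1 univ ∩ W c.1 univ ∈ 𝓝 w :=
        ((hWo b.1 univ b.2 univ_mem).inter (hWo c.1 univ c.2 univ_mem)).mem_nhds ⟨hwb, hwc⟩
      have hwS : w ∈ S := hCS hwC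
      have hfwb : f w ∈ J b := (hA1 b.1 univ b.2 univ_mem w hwb hwS).1
      have hfwc : f w ∈ J c := (hA1 c.1 univ c.2 univ_mem w hwc hwS).1
      have hagree : G b.1 univ =ᶠ[𝓝 (f w)] G c.1 univ := by
        have hεw := hε w (W b.1 univ ∩ W c.1 univ) hwC hO
        filter_upwards [Ioo_mem_nhds (show f w - ε w (W b.1 univ ∩ W c.1 univ) < f w by linarith)
          (show f w < f w + ε w (W b.1 univ ∩ W c.1 univ) by linarith)] with u hu
        obtain ⟨x', hx'W, hx'S, hfx', -, -⟩ := hA2 w (W b.1 univ ∩ W c.1 univ) hwC hO u hu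
        have hx'bc := hWO w (W b.1 univ ∩ W c.1 univ) hwC hO hx'W
        rw [← hfx', ← (hA1 b.1 univ b.2 univ_mem x' hx'bc.1 hx'S).2, ← (hA1 c.1 univ c.2 univ_mem x' hx'bc.2 hx'S).2]
      have hagree' : 𝔊 =ᶠ[𝓝 (f w)] G c.1 univ := by
        have h1 : 𝔊 =ᶠ[𝓝 (f w)] G b.1 univ := by
          filter_upwards [(hJo b).mem_nhds hfwb] with u hu
          exact hEb hu
        exact h1.trans hagree
      obtain ⟨𝔊', Υ', hD', hΥ', hΥL', hE𝔊, hEc⟩ := glue_step hUo hUc (hJo c) (hJc c) hD hΥ hΥL (hDG c) (hγan c)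
        (hγL c) (hJbU hfwb) hfwc hagree'
      refine ⟨U ∪ J c, 𝔊', Υ', hUo.union (hJo c), ?_, hJxU.trans subset_union_left, subset_union_right, hD', hΥ',
        hΥL', fun u hu => (hE𝔊 (hJxU hu)).trans (hEx hu), hEc⟩
      exact hUc.union (f w) (hJbU hfwb) hfwc (hJc c)
  -- conclude by the mean value inequality on the glued interval
  obtain ⟨U, 𝔊, Υ, -, hUc, hJxU, hJyU, hD, -, hΥL, hEx, hEy⟩ := key ⟨y, hy⟩ hchain
  have hfx : f x ∈ J ⟨x, hx⟩ := (hA1 x univ hx univ_mem x (hzW x univ hx univ_mem) (hCS hx)).1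
  have hfy : f y ∈ J ⟨y, hy⟩ := (hA1 y univ hy univ_mem y (hzW y univ hy univ_mem) (hCS hy)).1
  have hgx : g x = 𝔊 (f x) := by rw [(hA1 x univ hx univ_mem x (hzW x univ hx univ_mem) (hCS hx)).2, hEx hfx]
  have hgy : g y = 𝔊 (f y) := by rw [(hA1 y univ hy univ_mem y (hzW y univ hy univ_mem) (hCS hy)).2, hEy hfy]
  have hconv : Convex ℝ U := Real.convex_iff_isPreconnected.2 hUc
  have hmv := Convex.norm_image_sub_le_of_norm_hasDerivWithin_le (f := 𝔊) (f' := Υ) (C := L) (s := U)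
    (fun u hu => (hD u hu).hasDerivWithinAt) (fun u hu => by rw [Real.norm_eq_abs]; exact hΥL u hu) hconv
    (hJyU hfy) (hJxU hfx)
  rw [Real.norm_eq_abs, Real.norm_eq_abs] at hmv
  rw [hgx, hgy]
  exact hmv

/-- **Closure form.**  Under the hypotheses of `slice_le_of_analytic_regular_on`, the slice inequality extends to the CLOSURE of `C`
(e.g. to a closed cell: its sheet-trace boundary and its isolated critical points): `f` and `g` are continuous on the sphere, the
inequality is a closed condition on `S × S`, and `closure (C × C) = closure C × closure C`. [folklore] -/
theorem slice_le_of_analytic_regular_on_closure (hr : 0 < r) (hf : AnalyticOnNhd ℝ f ({x₀}ᶜ : Set E3))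
    (hμ : AnalyticOnNhd ℝ μ ({x₀}ᶜ : Set E3)) (hg : ContDiffOn ℝ 1 g ({x₀}ᶜ : Set E3))
    (hpar : ∀ x ∈ Metric.sphere x₀ r, cross (gradient g x - μ x • gradient f x) (x - x₀) = 0)
    (hL : ∀ x ∈ Metric.sphere x₀ r, |μ x| ≤ L)
    {C : Set E3} (hCS : C ⊆ Metric.sphere x₀ r) (hCreg : ∀ z ∈ C, cross (gradient f z) (z - x₀) ≠ 0)
    (hconn : IsPreconnected C) {x y : E3} (hx : x ∈ closure C) (hy : y ∈ closure C) :
    |g x - g y| ≤ L * |f x - f y| := by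
  set S : Set E3 := Metric.sphere x₀ r with hS
  have hSsub : S ⊆ ({x₀}ᶜ : Set E3) := fun z hz h0 => by
    rw [mem_singleton_iff] at h0
    have := mem_sphere_iff_norm.1 hz
    rw [h0, sub_self, norm_zero] at this
    exact hr.ne' this.symm
  have hfc : ContinuousOn f S := hf.continuousOn.mono hSsub
  have hgc : ContinuousOn g S := hg.continuousOn.mono hSsub
  -- the inequality is a closed condition on `S × S`
  set Φ : E3 × E3 → ℝ := fun p => L * |f p.1 - f p.2| - |g p.1 - g p.2| with hΦ
  have h1 : ContinuousOn (fun p : E3 × E3 => f p.1) (S ×ˢ S) := hfc.comp continuousOn_fst fun p hp => hp.1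
  have h2 : ContinuousOn (fun p : E3 × E3 => f p.2) (S ×ˢ S) := hfc.comp continuousOn_snd fun p hp => hp.2
  have h3 : ContinuousOn (fun p : E3 × E3 => g p.1) (S ×ˢ S) := hgc.comp continuousOn_fst fun p hp => hp.1
  have h4 : ContinuousOn (fun p : E3 × E3 => g p.2) (S ×ˢ S) := hgc.comp continuousOn_snd fun p hp => hp.2
  have hΦc : ContinuousOn Φ (S ×ˢ S) :=
    (continuousOn_const.mul (continuous_abs.comp_continuousOn (h1.sub h2))).sub
      (continuous_abs.comp_continuousOn (h3.sub h4))
  have hclosed : IsClosed (S ×ˢ S ∩ Φ ⁻¹' Ici 0) :=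
    hΦc.preimage_isClosed_of_isClosed (Metric.isClosed_sphere.prod Metric.isClosed_sphere) isClosed_Ici
  have hsub : C ×ˢ C ⊆ S ×ˢ S ∩ Φ ⁻¹' Ici 0 := by
    rintro ⟨a, b⟩ ⟨ha, hb⟩
    refine ⟨⟨hCS ha, hCS hb⟩, ?_⟩
    have hab := slice_le_of_analytic_regular_on hr hf hμ hg hpar hL hCS hCreg hconn ha hb
    simp only [mem_preimage, mem_Ici, hΦ]
    linarith
  have hcl : closure (C ×ˢ C) ⊆ S ×ˢ S ∩ Φ ⁻¹' Ici 0 := closure_minimal hsub hclosed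
  have hxy : (x, y) ∈ closure (C ×ˢ C) := by
    rw [closure_prod_eq]
    exact ⟨hx, hy⟩
  have h := (hcl hxy).2
  simp only [mem_preimage, mem_Ici, hΦ] at h
  linarith

end GluingOnSubsets

end Summit.NavierStokesRegularity.NavierStokesRegularity.Theorems.PoloidalLiouville.NetFlux

end
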